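import Summits.BirchSwinnertonDyer.BirchSwinnertonDyer.Theorems.PrintCf2RamifiedOffTYZInvisibleGenerator
import HarnessLib

/-!
# Route `PrintCf2`, crux stmt-BirchSwinnertonDyer-20509 `RamifiedOffTYZOfFacts` — `ρ(n)` READ OFF THE `A_n`-GENERATOR: `X(h) ∉ ℚ^{×2} ⟹ ρ(n) = 0`,
# `X(h) ∈ ℚ^{×2} ⟹ ρ(n) = 1` (the `ρ`-hypotheses of the line's C⁺-criteria discharged from the descent class `d(h)`)
# (cell `bsd-print-cf2`, LEAD of 20509 g18, line `offtyz-v7`, lineage cycle 19; fact-free, Theses-free, no `def`)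

HONEST FRAMING (crux 20509 = `𝔅_ram → WAllCornerFTwoRamifiedOffTYZProved`, DECIDING, OPEN AS A CLASS; C⁺ = `stub_offTYZ_levelTwoScriptLExact` = item
stmt-BirchSwinnertonDyer-23431, OPEN).  Pure `2`-isogeny descent bookkeeping over `ℚ` on `E_n : y² = x³ − n²x` and `A_n = E_n.twoIsogenyCodomain :
Y² = X³ + 4n²X` with the tree's explicit isogeny `φ : E_n → A_n`, its dual `ψ = ψQ`, Silverman–Tate's `α = xSqClass`, and the W2 index lemma `stub_S1`
(`ψ(α₀) = ±2^ρ R + t₂`, `2^ρ = [E_n(ℚ) : φ_n(A_n(ℚ)) + E_n[2]]`).  Nothing is asserted; no named fact; no BSD / GZK.  The lineage's C⁺ criteria on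
`{ρ = 0}` / `{ρ = 1}` (g3 `…LevelTwoRhoValve`, this seat's `…GeneratorDepthRhoOne`, `…InvisibleGenerator`) take `(rhoSubgroup n).index = 1` or `= 2` as a
HYPOTHESIS; this file computes it from the `A_n`-generator `h = (X, Y)` (rank one), so that the block-free structure theorem of the companion file
`…BlockFreeStructure` is indexed by `d(h) = [X] ∈ ℚ^×/ℚ^{×2}` alone.

* `xSqClass_twoIsogenyFun_eq_one` — `α(φ(P)) = 1` (`X(φ(x,y)) = (y/x)²`; `α(T̄) = [4n²] = 1`).
* ★ `rhoIndex_eq_one_of_X_not_sq` — **`X(h) ∉ ℚ^{×2} ⟹ [E_n(ℚ) : φ_n(A_n(ℚ)) + E_n[2]] = 1`**: if `ρ ≥ 1`, `ψ(h − φ(±2^{ρ−1}R)) = t₂ ∈ E_n[2]`, so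
  `τ := h − φ(·)` has `2τ ∈ ker ψ = {O, T̄}`; `A_n(ℚ)` has no point of order `4` above `T̄` (the duplication formula `x(2τ)·(2y)² = (x² − 4n²)²` forces
  `x = ±2n`, `y² = ±16n³`, absurd for square-free `n > 1`) and its other `2`-torsion is absent (`x² + 4n² ≠ 0`), so `α(h) = α(τ)α(φ(·)) = 1`.
* ★ `rhoIndex_eq_two_of_X_sq` — **`X(h) ∈ ℚ^{×2} ⟹ the index is `2`**: `h = φ(P′)` (`ker ᾱ ⊆ φ(Γ)`, `mem_range_twoIsogenyFun_of_xSqClass_eq_one`), so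
  `ψ(h) = 2P′` and `ρ = 0` would make the Mordell–Weil generator `R ≡ 2(±P′)` torsion; `ρ ≤ 1` because `2R = ψ(φ(R)) ∈ ψ(A_n(ℚ))`.

Beyond-print theorem: NO (descent bookkeeping).  BSD is not proved by any of this; no class is closed by this file.

References: [cite: TianYuanZhang2017, §1 (arXiv:1411.4728 chunk p0002 L101–L110: `ρ(n)`, `φ_n : A_n → E_n`), §3.1 (p0011 L27–L36, L58–L66),
Prop. 3.2 (3) (p0010 L112), Thm. 3.5 (p0011 L94–L100), Lemma 3.18 (p0017 L152–L153)]; [cite: SilvermanTate2015, §3.4 Prop. 3.7, Prop. 3.8(b), §3.5 (the map α)];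
[cite: SilvermanAEC2009, III.2.3(d), Prop. X.1.4, X.4.9]; [cite: Darmon2004, Thm. 3.22] (GZK, binder `hGZK`); [cite: Lang2002, VI §1 Thm. 1.2, Cor. 1.4];
tree: `Literature/…/IsogenyTwoTorsionProofs` (`twoIsogenyFun`, `addX_self_mul`), `…/TwoIsogenyDualPoints` (`twoIsogenyDualFun_twoIsogenyFun'`),
`…/TwoIsogenyDescentAlpha` (`xSqClass`, `xSqClass_add`), `…/TwoIsogenySelmerGroupRankProofs` (`mem_range_twoIsogenyFun_of_xSqClass_eq_one`),
`TianYuanZhang2017/GenusDescentEnSide` (`stub_S0`, `stub_S1`, `stub_S3`, `ψQ`), this seat's `…GeneratorDepthRhoOne`, `…InvisibleGenerator` and g3/g16's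
`…LevelTwoRhoValve`, `…VisibleGenerator`, `…LowerHalfVisibleSeven`; LEAD memo `Cruxes/RamifiedOffTYZOfFacts/Lines/offtyz_v7_GeneratorDepth.md` §7.
-/

noncomputable section

open scoped Classical

open WeierstrassCurve WeierstrassCurve.Affine WeierstrassCurve.Affine.Point
  Literature.NumberTheory.EllipticCurves Literature.NumberTheory.EllipticCurves.Rank1Residual
  Summit.BirchSwinnertonDyer.Rank1Residual
  Literature.NumberTheory.EllipticCurves.TianYuanZhang2017
  Literature.NumberTheory.EllipticCurves.TianYuanZhang2017.W2
  Summit.BirchSwinnertonDyer.PrintCf2.GaloisMotion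
  Summit.BirchSwinnertonDyer.Rank1Residual.P2.ThetaDescent
  Summit.BirchSwinnertonDyer.PrintCf2.LowerHalfVisible
  Summit.BirchSwinnertonDyer.PrintCf2.VisibleGenerator

set_option autoImplicit false

namespace Summit.BirchSwinnertonDyer.PrintCf2.BlockFreeStructure

variable {n : ℕ}

/-! ## §1 `ρ(n)` from the `A_n`-generator: if `X(h)` is not a rational square then `[E_n(ℚ) : φ_n(A_n(ℚ)) + E_n[2]] = 1` -/

/-- A square-free natural number `> 1` is not the square of a rational number. [folklore] -/
private theorem not_sq_eq_natCast {n : ℕ} (hsq : Squarefree n) (hn1 : 1 < n) (q : ℚ) : q ^ 2 ≠ (n : ℚ) := by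
  intro h
  have hsqQ : IsSquare (n : ℚ) := ⟨q, by rw [← h, sq]⟩
  obtain ⟨m, hm⟩ := Rat.isSquare_natCast_iff.1 hsqQ
  have hmu : IsUnit m := hsq m ⟨1, by rw [mul_one]; exact hm⟩
  rw [Nat.isUnit_iff] at hmu
  subst hmu
  omega

/-- The image of the explicit `2`-isogeny `φ : E_n(ℚ) → A_n(ℚ)` has trivial `X`-class: `α(φ(P)) = 1` (`X(φ(x,y)) = (y/x)²`; `φ(O) = φ(T) = O`;
`X = 0` only at `T̄` with `α(T̄) = [4n²] = 1`). [cite: SilvermanTate2015, §3.4 (i)–(iii), §3.5] -/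
theorem xSqClass_twoIsogenyFun_eq_one (hsq : Squarefree n)
    (P : (congruentNumberCurve n).toAffine.Point) :
    haveI := isElliptic_congruentNumberCurve hsq.ne_zero
    (Atwo n).xSqClass ((congruentNumberCurve n).twoIsogenyFun P) = 1 := by
  haveI := isElliptic_congruentNumberCurve hsq.ne_zero
  have hnQ : (n : ℚ) ≠ 0 := by exact_mod_cast hsq.ne_zero
  rcases P with _ | ⟨x, y, hP⟩
  · show (Atwo n).xSqClass ((congruentNumberCurve n).twoIsogenyFun 0) = 1
    rw [twoIsogenyFun_zero, xSqClass_zero]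
  · by_cases hx : x = 0
    · rw [twoIsogenyFun_some_of_eq_zero _ hP hx, xSqClass_zero]
    · rw [twoIsogenyFun_some _ hP hx]
      have hXsq : (congruentNumberCurve n).twoIsogenyX x * x ^ 2 = y ^ 2 := twoIsogenyX_mul_sq _ hP hx
      by_cases hX0 : (congruentNumberCurve n).twoIsogenyX x = 0
      · rw [xSqClass_some_of_eq_zero _ hX0, Atwo_a₄, sqClass_eq_one_iff (by positivity)]
        exact ⟨2 * n, by ring⟩
      · rw [xSqClass_some_of_ne_zero _ hX0, sqClass_eq_one_iff hX0]
        exact ⟨y / x, by field_simp; linear_combination hXsq⟩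

/-- **`X(h) ∉ ℚ^{×2}` ⟹ `ρ(n) = 0`.**  Square-free `n > 1` with `rank E_n(ℚ) = 1`; `h = (X, Y)` a generator of `A_n(ℚ)` modulo torsion
(`A_n = Y² = X³ + 4n²X`) whose abscissa is NOT a rational square.  Then `[E_n(ℚ) : φ_n(A_n(ℚ)) + E_n[2]] = 1`.  (If `ρ ≥ 1`, the index lemma
`ψ(h) = ±2^ρ R + t₂` and `ψ ∘ φ = 2` give `ψ(h − φ(±2^{ρ−1}R)) = t₂ ∈ E_n[2]`, so `τ := h − φ(±2^{ρ−1}R)` has `2τ ∈ {O, T̄}`; `A_n(ℚ)` has no point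
of order `4` above `T̄` (`X² = 4n²` forces `Y² = ±16n³`, `n` not a square) and its `2`-torsion is `{O, T̄}`; hence `α(h) = α(τ)·α(φ(·)) = 1`, i.e.
`X(h)` is a square.) [cite: TianYuanZhang2017, §1 (p0002 L101–L110: ρ(n), φ_n)] [cite: SilvermanTate2015, §3.4–3.5] [cite: SilvermanAEC2009, III.2.3(d), X.4.9] -/
theorem rhoIndex_eq_one_of_X_not_sq (hsq : Squarefree n) (hn1 : 1 < n)
    (hrank : haveI := isElliptic_congruentNumberCurve hsq.ne_zero; (congruentNumberCurve n).mordellWeilRank = 1)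
    {X Y : ℚ} (h : (Atwo n).toAffine.Nonsingular X Y)
    (hgen : ∀ P : (Atwo n).toAffine.Point, ∃ m : ℤ, IsOfFinAddOrder (P - m • (Point.some X Y h : (Atwo n).toAffine.Point)))
    (hX : ¬ ∃ q : ℚ, X = q ^ 2) : (rhoSubgroup n).index = 1 := by
  haveI := isElliptic_congruentNumberCurve hsq.ne_zero
  have hn0 : n ≠ 0 := hsq.ne_zero
  have hnQ : (n : ℚ) ≠ 0 := by exact_mod_cast hn0
  obtain ⟨ρ, hρ⟩ := stub_S3 hsq
  rcases Nat.eq_zero_or_pos ρ with rfl | hρpos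
  · simpa using hρ
  exfalso
  obtain ⟨r, rfl⟩ : ∃ r, ρ = r + 1 := ⟨ρ - 1, by omega⟩
  obtain ⟨R, hR⟩ := stub_S0 (n := n) hrank.le
  obtain ⟨ε, hε, t₂, ht₂, hψ⟩ := stub_S1 hsq (ψQ n) xSqClass_eq_one_iff_exists_ψQ hρ hR hgen
  -- `φ(P)` for `P = (ε 2^r) R`, with `ψ(φ P) = 2P`
  set P : (congruentNumberCurve n).toAffine.Point := (ε * 2 ^ r) • R with hPdef
  set φP : (Atwo n).toAffine.Point := (congruentNumberCurve n).twoIsogenyFun P with hφP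
  have hψφ : ψQ n φP = (2 : ℕ) • P := by
    rw [hφP]
    change (congruentNumberCurve n).twoIsogenyDualHomOf _ = _
    rw [twoIsogenyDualHomOf_apply, twoIsogenyDualFun_twoIsogenyFun']
  have hψφ' : ψQ n φP = (ε * 2 ^ (r + 1)) • R := by
    rw [hψφ, hPdef, ← natCast_zsmul, smul_smul]; congr 1; push_cast; ring
  -- `τ := h − φP` has `ψ τ = t₂`
  set τ : (Atwo n).toAffine.Point := Point.some X Y h - φP with hτ
  have hψτ : ψQ n τ = t₂ := by
    rw [hτ, map_sub, hψ, hψφ']; abel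
  have h2τ : (2 : ℕ) • τ = 0 ∨ (2 : ℕ) • τ = (Atwo n).twoTorsionPoint := by
    rw [← ψQ_eq_zero_iff, map_nsmul, hψτ, ht₂]
  -- `α(h) = α(τ)` since `α(φP) = 1`
  have hαh : (Atwo n).xSqClass (Point.some X Y h) = (Atwo n).xSqClass τ := by
    have e : (Point.some X Y h : (Atwo n).toAffine.Point) = τ + φP := by rw [hτ, sub_add_cancel]
    have hadd := xSqClass_add (Atwo n) τ φP
    have hφ1 : (Atwo n).xSqClass φP = 1 := by rw [hφP]; convert xSqClass_twoIsogenyFun_eq_one hsq P using 2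
    rw [hφ1, mul_one] at hadd
    rw [e]
    convert hadd using 4
    all_goals congr!
  -- `α(τ) = 1`: `τ ∈ {O, T̄}` (no point of order 4 above `T̄`, no other rational 2-torsion)
  have hA4 : (Atwo n).a₄ = 4 * (n : ℚ) ^ 2 := Atwo_a₄
  have hατ : (Atwo n).xSqClass τ = 1 := by
    rcases τ with _ | ⟨x, y, hxy⟩
    · exact xSqClass_zero _
    · have hrel : y ^ 2 = x ^ 3 + 4 * (n : ℚ) ^ 2 * x := Atwo_equation hxy
      have hnegY : (Atwo n).toAffine.negY x y = -y := negY_of_isTwoTorsionNF _ x y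
      rcases h2τ with h0 | hT
      · -- `2τ = 0`: `y = 0`, then `x(x² + 4n²) = 0`, `x = 0`: `τ = T̄`, `α = [4n²] = 1`
        have hy : y = 0 := by
          have e : (Point.some x y hxy : (Atwo n).toAffine.Point) = -Point.some x y hxy := by
            rw [← add_eq_zero_iff_eq_neg, ← two_nsmul]; exact h0
          rw [Point.neg_some] at e
          have e2 := (Point.some.inj e).2
          rw [hnegY] at e2
          linarith
        have hx : x = 0 := by
          rw [hy] at hrel
          have : x * (x ^ 2 + 4 * (n : ℚ) ^ 2) = 0 := by linear_combination -hrel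
          rcases mul_eq_zero.mp this with hx | hx
          · exact hx
          · nlinarith [sq_nonneg x, sq_nonneg (n : ℚ)]
        rw [xSqClass_some_of_eq_zero _ hx, hA4, sqClass_eq_one_iff (by positivity)]
        exact ⟨2 * n, by ring⟩
      · -- `2τ = T̄`: impossible (`x(2τ) = 0` forces `x² = 4n²`, then `y² = ±16n³`)
        exfalso
        have hT0 : (Atwo n).twoTorsionPoint ≠ 0 := by
          unfold WeierstrassCurve.twoTorsionPoint; exact Point.some_ne_zero _
        have hy0 : y ≠ 0 := by
          intro hy
          have e0 : (2 : ℕ) • (Point.some x y hxy : (Atwo n).toAffine.Point) = 0 := by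
            rw [two_nsmul, add_eq_zero_iff_eq_neg, Point.neg_some]
            congr 1; rw [hnegY, hy, _root_.neg_zero]
          rw [e0] at hT
          exact hT0 hT.symm
        have hy' : y ≠ (Atwo n).toAffine.negY x y := by
          rw [hnegY]; intro e; apply hy0; linarith
        have hdup := addX_self_mul (Atwo n) hxy hy'
        rw [two_nsmul, Point.add_self_of_Y_ne hy'] at hT
        unfold WeierstrassCurve.twoTorsionPoint at hT
        obtain ⟨hx2, -⟩ := Point.some.inj hT
        have h0 : (x ^ 2 - (Atwo n).a₄) ^ 2 = 0 := by
          rw [← hdup, mul_eq_zero]; left; convert hx2 using 2; all_goals congr!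
        rw [hA4] at h0
        have hx4 : x ^ 2 = 4 * (n : ℚ) ^ 2 := by nlinarith [sq_nonneg (x ^ 2 - 4 * (n : ℚ) ^ 2)]
        have hnpos : (0 : ℚ) < n := by exact_mod_cast (show 0 < n by omega)
        rcases sq_eq_sq_iff_eq_or_eq_neg.mp (show x ^ 2 = (2 * (n : ℚ)) ^ 2 by rw [hx4]; ring) with hx | hx
        · -- `y² = 16n³`: `(y/(4n))² = n`
          apply not_sq_eq_natCast hsq hn1 (y / (4 * n))
          rw [div_pow]; field_simp; rw [hx] at hrel; linear_combination hrel
        · rw [hx] at hrel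
          nlinarith [sq_nonneg y, pow_pos hnpos 3]
  -- so `X` is a square
  rw [hατ] at hαh
  have hX0 : X ≠ 0 := by
    intro hx0
    -- `h = T̄` would be torsion, contradicting rank one
    have hrank2 : 1 ≤ (Atwo n).mordellWeilRank := by
      rw [← (congruentNumberCurve n).twoIsogeny.mordellWeilRank_eq, hrank]
    obtain ⟨x₀, hx₀⟩ := LevelTwo.exists_not_isOfFinAddOrder_of_one_le_rank (Atwo n) hrank2
    have hnt : ¬ IsOfFinAddOrder (Point.some X Y h : (Atwo n).toAffine.Point) :=
      LevelTwo.not_isOfFinAddOrder_of_generates hx₀ (hgen x₀)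
    have hY : Y = 0 := by
      have := Atwo_equation h; rw [hx0] at this; nlinarith [sq_nonneg Y]
    apply hnt
    have e : (Point.some X Y h : (Atwo n).toAffine.Point) = (Atwo n).twoTorsionPoint := by
      subst hx0 hY; rfl
    rw [e]; convert isOfFinAddOrder_twoTorsionPoint (Atwo n) using 3; all_goals congr!
  rw [xSqClass_some_of_ne_zero _ hX0, sqClass_eq_one_iff hX0] at hαh
  exact hX hαh


/-- **`X(h) ∈ ℚ^{×2}` ⟹ `ρ(n) = 1`** (the converse reading): square-free `n > 1`, `rank E_n(ℚ) = 1`, `h = (X, Y)` a generator of `A_n(ℚ)`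
modulo torsion with `X = q²`.  Then `[E_n(ℚ) : φ_n(A_n(ℚ)) + E_n[2]] = 2`.  (`h = φ(P′)` by Silverman–Tate's `ker ᾱ ⊆ φ(Γ)`, so `ψ(h) = 2P′`;
with `ψ(h) = ±2^ρ R + t₂` this forces `ρ ≥ 1`; and `ρ ≤ 1` because `2R = ψ(φ(R)) ∈ ψ(A_n(ℚ))`.)
[cite: TianYuanZhang2017, §1 (p0002 L101–L110)] [cite: SilvermanTate2015, §3.4 Prop. 3.7, Prop. 3.8(b), §3.5] -/
theorem rhoIndex_eq_two_of_X_sq (hsq : Squarefree n)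
    (hrank : haveI := isElliptic_congruentNumberCurve hsq.ne_zero; (congruentNumberCurve n).mordellWeilRank = 1)
    {X Y : ℚ} (h : (Atwo n).toAffine.Nonsingular X Y)
    (hgen : ∀ P : (Atwo n).toAffine.Point, ∃ m : ℤ, IsOfFinAddOrder (P - m • (Point.some X Y h : (Atwo n).toAffine.Point)))
    (hX : ∃ q : ℚ, X = q ^ 2) : (rhoSubgroup n).index = 2 := by
  haveI := isElliptic_congruentNumberCurve hsq.ne_zero
  have hn0 : n ≠ 0 := hsq.ne_zero
  obtain ⟨ρ, hρ⟩ := stub_S3 hsq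
  obtain ⟨R, hR⟩ := stub_S0 (n := n) hrank.le
  obtain ⟨x₀, hx₀⟩ := LevelTwo.exists_not_isOfFinAddOrder_of_one_le_rank (congruentNumberCurve n) hrank.ge
  have hRnt : ¬ IsOfFinAddOrder R := LevelTwo.not_isOfFinAddOrder_of_generates hx₀ (hR x₀)
  obtain ⟨ε, hε, t₂, ht₂, hψ⟩ := stub_S1 hsq (ψQ n) xSqClass_eq_one_iff_exists_ψQ hρ hR hgen
  have ht₂' : IsOfFinAddOrder t₂ := isOfFinAddOrder_iff_nsmul_eq_zero.mpr ⟨2, two_pos, ht₂⟩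
  have hε2 : ε * ε = 1 := by rcases hε with rfl | rfl <;> norm_num
  -- `ρ ≤ 1`: `2R = ψ(φ R)` and `φ R ≡ m h`
  have hρle : ρ ≤ 1 := by
    by_contra hρ2
    obtain ⟨m, hm⟩ := hgen ((congruentNumberCurve n).twoIsogenyFun R)
    have h2R : ψQ n ((congruentNumberCurve n).twoIsogenyFun R) = (2 : ℕ) • R := by
      change (congruentNumberCurve n).twoIsogenyDualHomOf _ = _
      rw [twoIsogenyDualHomOf_apply, twoIsogenyDualFun_twoIsogenyFun']
    -- `2R − m ψ(h)` torsion, `ψ(h) = ε 2^ρ R + t₂`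
    have htor : IsOfFinAddOrder ((2 : ℤ) • R - (m * (ε * 2 ^ ρ)) • R) := by
      have h1 := (ψQ n).isOfFinAddOrder hm
      rw [map_sub, map_zsmul, h2R, hψ] at h1
      have e : ((2 : ℕ) • R - m • ((ε * 2 ^ ρ) • R + t₂)) + m • t₂ = (2 : ℤ) • R - (m * (ε * 2 ^ ρ)) • R := by
        rw [show (2 : ℕ) • R = (2 : ℤ) • R from (natCast_zsmul R 2).symm]; module
      rw [← e]; exact h1.add ht₂'.zsmul
    rw [← sub_smul] at htor
    have hcoef : (2 : ℤ) - m * (ε * 2 ^ ρ) ≠ 0 := by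
      obtain ⟨j, rfl⟩ : ∃ j, ρ = j + 2 := ⟨ρ - 2, by omega⟩
      intro h0
      have : (2 : ℤ) = 4 * (m * ε * 2 ^ j) := by linear_combination h0
      omega
    exact hRnt (LevelTwo.isOfFinAddOrder_of_zsmul hcoef htor)
  -- `ρ ≥ 1`: `h = φ(P′)`, so `ψ(h) = 2P′`
  have hρge : 1 ≤ ρ := by
    by_contra hρ0
    have hρ0' : ρ = 0 := by omega
    subst hρ0'
    obtain ⟨q, hq⟩ := hX
    have hX0 : X ≠ 0 := by
      intro hx0
      have hrank2 : 1 ≤ (Atwo n).mordellWeilRank := by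
        rw [← (congruentNumberCurve n).twoIsogeny.mordellWeilRank_eq, hrank]
      obtain ⟨x₁, hx₁⟩ := LevelTwo.exists_not_isOfFinAddOrder_of_one_le_rank (Atwo n) hrank2
      have hnt : ¬ IsOfFinAddOrder (Point.some X Y h : (Atwo n).toAffine.Point) :=
        LevelTwo.not_isOfFinAddOrder_of_generates hx₁ (hgen x₁)
      have hY : Y = 0 := by
        have := Atwo_equation h; rw [hx0] at this; nlinarith [sq_nonneg Y]
      apply hnt
      have e : (Point.some X Y h : (Atwo n).toAffine.Point) = (Atwo n).twoTorsionPoint := by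
        subst hx0 hY; rfl
      rw [e]; convert isOfFinAddOrder_twoTorsionPoint (Atwo n) using 3; all_goals congr!
    have hcls : (Atwo n).xSqClass (Point.some X Y h) = 1 := by
      rw [xSqClass_some_of_ne_zero _ hX0, sqClass_eq_one_iff hX0]; exact ⟨q, hq⟩
    have hmem := mem_range_twoIsogenyFun_of_xSqClass_eq_one (congruentNumberCurve n) _ (by convert hcls using 2)
    obtain ⟨P', hP'⟩ := hmem
    have h2P : ψQ n (Point.some X Y h) = (2 : ℕ) • P' := by
      change (congruentNumberCurve n).twoIsogenyDualHomOf _ = _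
      rw [twoIsogenyDualHomOf_apply]
      have e : (congruentNumberCurve n).twoIsogenyDualFun (Point.some X Y h) =
          (congruentNumberCurve n).twoIsogenyDualFun ((congruentNumberCurve n).twoIsogenyFun P') := by
        congr 1; exact hP'.symm
      rw [e, twoIsogenyDualFun_twoIsogenyFun']
    -- `ε R + t₂ = 2P′`, `P′ ≡ jR`: `(ε − 2j) R` torsion
    obtain ⟨j, hj⟩ := hR P'
    rw [hψ, pow_zero, mul_one] at h2P
    have h2Pz : (2 : ℤ) • P' = ε • R + t₂ := by
      rw [show (2 : ℤ) = ((2 : ℕ) : ℤ) from rfl, natCast_zsmul]; exact h2P.symm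
    have e : (ε - 2 * j) • R = (2 : ℤ) • (P' - j • R) - t₂ := by
      rw [sub_smul, mul_smul, smul_sub, h2Pz]; abel
    have htor : IsOfFinAddOrder ((ε - 2 * j) • R) := by
      rw [e, sub_eq_add_neg]; exact hj.zsmul.add ht₂'.neg
    have hcoef : ε - 2 * j ≠ 0 := by rcases hε with rfl | rfl <;> omega
    exact hRnt (LevelTwo.isOfFinAddOrder_of_zsmul hcoef htor)
  interval_cases ρ
  simpa using hρ


end Summit.BirchSwinnertonDyer.PrintCf2.BlockFreeStructure

end
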